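import Summits.BirchSwinnertonDyer.Rank1Residual.Additive.GordHigherCongruentPairGVBudget
import Summits.BirchSwinnertonDyer.Rank1Residual.Additive.GordHigherCongruentPairGVOfS2
import HarnessLib

/-!
# Route-G BUDGETS on (G-ord) receivers of ANY semistability defect with the receiver's R-D
# identification fed by cc-typer-2's S2 record (p05's T-RD-E346 K5) — partner of defect 2 in RANK
# currency, `p ≥ 5`, off the swap locus
# (cell `b2b-bsdres`, team n1011, seat p07 (gen 7); row T-ROL-EXP FILE F2; sequel of FILE E)

HONEST FRAMING (cell `b2b-bsdres`, run/shared/lean/b2b/bsd-rank1-residual/, verbatim in every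
file): the goal of the cell is to DELETE the COMBINATION-SHAPED residual classes of the
Birch–Swinnerton-Dyer formula for ALL analytic-rank `≤ 1` elliptic curves over `ℚ` — "full BSD
formula for every rank `≤ 1` curve in class `C`" assembled STRICTLY from published theorems — so
that the rank-`≤ 1` remainder becomes exactly the CONSTRUCTION-SHAPED classes, which are TYPED
(missing-input `Prop`s), NOT attempted. This is not "finishing BSD". Team n1011 (N10/N11, (G-ord)
rows of every defect): research route; labels and marks UNCHANGED; nothing booked. TOOL theorems only:
NO definition, NO named fact. CONDITIONAL on the tree's EXISTING records exactly as the consumed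
files: `hGV` (A240, = p12's `…_of_records h23 h414`), `hS2` (S2; A239 derived from it), `hT40`/`hT41`
(A40/A41), `hK` (Kato 17.4 (3)), `hW16` (Wuthrich Thm. 16), `hmodD`.

## What and why

FILE E (`GordHigherCongruentPairGVBudget`) typed `BudgetLeLambdaAt p E b` on a (G-ord) receiver of any
defect with the receiver's R-D identification `RamifiedLineKummerEqAt W p` as a binder. FILE F's
`ramifiedLineKummerEqAt_of_s2_of_typeGOrd` (p05's K5 + A239 ⇐ S2) discharges it mod S2; this file
substitutes it: the RANK-currency budgets on X4♯(G-ord) / X3♯(G-ord) receivers of ANY defect from a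
(G-ord, `e = 2`) or (M) partner now carry EXACTLY the binder list of the defect-2 budgets of record
(p07-g6 `GordCongruentPairGVBudget` §2) with `he` replaced by `hS2` + `¬ (p−1) ∣ lcm(e, 2)`.

References: R. Greenberg, V. Vatsal, Invent. Math. 142 (2000) §2 Prop. (2.8), Remark (2.9), Cor. (2.3),
Prop. (2.4), pp. 26–27 [GreenbergVatsal2000]; R. Greenberg, LNM 1716 (1999) §2 Prop. 2.4, Prop. 4.14
[GreenbergLNM1716]; K. Kato, Astérisque 295 (2004) Thm. 17.4 (3) [Kato2004Asterisque]; C. Wuthrich,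
J. London Math. Soc. 89 (2014) Thm. 16 [Wuthrich2014]; cells/n1011/skel/T-ROL-EXP.md (67779f27699eb635).
-/

set_option autoImplicit false

noncomputable section

open scoped Classical MatrixGroups ModularForm NumberField

open CongruenceSubgroup WeierstrassCurve NumberField IsDedekindDomain Field
  Literature.NumberTheory.EllipticCurves
  Literature.NumberTheory.EllipticCurves.ModularForms
  Literature.NumberTheory.EllipticCurves.Rank1Residual
  Literature.NumberTheory.EllipticCurves.Rank1Residual.Typed
  Literature.NumberTheory.EllipticCurves.GreenbergSelmer
  Literature.NumberTheory.EllipticCurves.Greenberg1999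
  Literature.NumberTheory.EllipticCurves.Wuthrich2014
  Literature.NumberTheory.EllipticCurves.GreenbergVatsal2000
  Literature.NumberTheory.GaloisRepresentations
  Summit.BirchSwinnertonDyer.Rank1Residual.X1.MuLambda
  Summit.BirchSwinnertonDyer.Rank1Residual.X11a
  Summit.BirchSwinnertonDyer.Rank1Residual.Iwasawa

open Summit.BirchSwinnertonDyer.Rank1Residual.X1.CongruenceTransfer (TorsionIso CongruentLambdaShift)

namespace Summit.BirchSwinnertonDyer.Rank1Residual.Additive

open Summit.BirchSwinnertonDyer.Rank1Residual.AdditivePotMult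
open GordHigherCongruentPairGVOfS2

variable {W W₁ : WeierstrassCurve ℚ} [W.IsElliptic] [W.IsGloballyMinimal] [W₁.IsElliptic]
  [W₁.IsGloballyMinimal] {p : ℕ} [hp : Fact p.Prime]

/-- **X4♯(G-ord) receiver of ANY defect, X4♯(G-ord) ∩ `I₀*` ∧ surj(p) partner of rank `≥ r₁`
(`p ≥ 5`, `(p−1) ∤ lcm(e, 2)`): the EPW-free Route-G budget with EVERY per-curve binder from records**
— `hGV`, `hS2`, `hK`, `hmodD`, a `TorsionIso` certificate, `Σ₀`, `ρ̄_{E₁,p}` onto, `r₁ ≤ rank E₁(ℚ)`;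
NO `he` on the receiver, NO R-D binder (FILE E with `hRD := ramifiedLineKummerEqAt_of_s2_of_typeGOrd`,
`hGrK := A239 ⇐ S2`). PER PAIR; X4♯(G-ord) stays CONSTRUCTION-SHAPED; nothing booked.
[cite: GreenbergVatsal2000, §2 Prop. (2.8) with Remark (2.9), Cor. (2.3), Prop. (2.4), pp. 26–27 (arXiv:math/9906215)]
[cite: Kato2004Asterisque, Thm. 17.4 (3) (p. 273)] [cite: GreenbergLNM1716, §2 Prop. 2.4, §3 Lemma 3.1] -/
theorem ClassX4Gord.budgetLeLambdaAt_of_gv_of_s2_of_gordTwoPartner_of_rank_of_not_dvd_lcm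
    (hGV : muLambdaAlg_transfer_of_torsionIso_potOrd_of_not_dvd_torsionOrder)
    (hS2 : imKummer_ge_strictCondition_goodOrdinaryModel)
    (hK : Wuthrich2014.kato_halfEigenCharIdeal_dvd_cyclotomicPrime_of_surjective)
    (hmodD : nonempty_modularParametrizationData) (hp5 : 5 ≤ p) (hX : ClassX4Gord W p)
    (hX₁ : ClassX4Gord W₁ p) (he₁ : semistabilityIndex W₁ p = 2) (hsurj₁ : Surj W₁ p) {r₁ : ℕ}
    (hr₁ : r₁ ≤ W₁.mordellWeilRank) (hlcm : ¬ (p - 1) ∣ Nat.lcm (semistabilityIndex W p) 2)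
    (hT : TorsionIso W W₁ p)
    (S₀ : Finset (HeightOneSpectrum (𝓞 ℚ))) (hS₀ : ∀ w ∈ S₀, ((p : ℕ) : 𝓞 ℚ) ∉ w.asIdeal)
    (hS : ∀ w : HeightOneSpectrum (𝓞 ℚ), w ∉ S₀ → ((p : ℕ) : 𝓞 ℚ) ∉ w.asIdeal →
      W.HasGoodReductionAt w)
    (hS₁ : ∀ w : HeightOneSpectrum (𝓞 ℚ), w ∉ S₀ → ((p : ℕ) : 𝓞 ℚ) ∉ w.asIdeal →
      W₁.HasGoodReductionAt w)
    {b : ℕ} (hb : (b : ℤ) ≤ r₁ + ∑ w ∈ S₀, ((delta W₁ p w : ℤ) - (delta W p w : ℤ))) :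
    BudgetLeLambdaAt p W b :=
  hX.budgetLeLambdaAt_of_gv_of_gordTwoPartner_of_rank_of_not_dvd_lcm hGV
    (imKummer_ge_strictCondition_goodOrdinary_of_goodOrdinaryModel hS2) hK hmodD hp5
    (ramifiedLineKummerEqAt_of_s2_of_typeGOrd hS2 hp5 hX.typeGOrd hX.addv.2) hX₁ he₁ hsurj₁ hr₁ hlcm hT S₀
    hS₀ hS hS₁ hb

/-- **X4♯(G-ord) receiver of ANY defect, X4(M) ∧ surj(p) partner of rank `≥ r₁` (`p ≥ 5`,
`(p−1) ∤ lcm(e, 2)`): the EPW-free Route-G budget with every per-curve binder from records** (`hGV`,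
`hS2`, A40/A41, `hK`, `hmodD`). PER PAIR; nothing booked.
[cite: GreenbergVatsal2000, §2 Prop. (2.8) with Remark (2.9), Cor. (2.3), Prop. (2.4), pp. 26–27 (arXiv:math/9906215)]
[cite: Kato2004Asterisque, Thm. 17.4 (3) (p. 273)] [cite: SilvermanATAEC1994, Ch. V Thm. 5.3, Cor. 5.4] -/
theorem ClassX4Gord.budgetLeLambdaAt_of_gv_of_s2_of_multPartner_of_rank_of_not_dvd_lcm
    (hGV : muLambdaAlg_transfer_of_torsionIso_potOrd_of_not_dvd_torsionOrder)
    (hS2 : imKummer_ge_strictCondition_goodOrdinaryModel)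
    (hK : Wuthrich2014.kato_halfEigenCharIdeal_dvd_cyclotomicPrime_of_surjective)
    (hmodD : nonempty_modularParametrizationData)
    (hT40 : Silverman1994_thmV53_tateUniformisation.{0})
    (hT41 : Silverman1994_thmV53_corV54_tateUniformisation.{0}) (hp5 : 5 ≤ p) (hX : ClassX4Gord W p)
    (hX₁ : ClassX4M W₁ p) (hsurj₁ : Surj W₁ p) {r₁ : ℕ} (hr₁ : r₁ ≤ W₁.mordellWeilRank)
    (hlcm : ¬ (p - 1) ∣ Nat.lcm (semistabilityIndex W p) 2) (hT : TorsionIso W W₁ p)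
    (S₀ : Finset (HeightOneSpectrum (𝓞 ℚ))) (hS₀ : ∀ w ∈ S₀, ((p : ℕ) : 𝓞 ℚ) ∉ w.asIdeal)
    (hS : ∀ w : HeightOneSpectrum (𝓞 ℚ), w ∉ S₀ → ((p : ℕ) : 𝓞 ℚ) ∉ w.asIdeal →
      W.HasGoodReductionAt w)
    (hS₁ : ∀ w : HeightOneSpectrum (𝓞 ℚ), w ∉ S₀ → ((p : ℕ) : 𝓞 ℚ) ∉ w.asIdeal →
      W₁.HasGoodReductionAt w)
    {b : ℕ} (hb : (b : ℤ) ≤ r₁ + ∑ w ∈ S₀, ((delta W₁ p w : ℤ) - (delta W p w : ℤ))) :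
    BudgetLeLambdaAt p W b :=
  hX.budgetLeLambdaAt_of_gv_of_multPartner_of_rank_of_not_dvd_lcm hGV hK hmodD hT40 hT41 hp5
    (ramifiedLineKummerEqAt_of_s2_of_typeGOrd hS2 hp5 hX.typeGOrd hX.addv.2) hX₁ hsurj₁ hr₁ hlcm hT S₀
    hS₀ hS hS₁ hb

/-- **X3♯(G-ord) receiver of ANY defect, X3♯(G-ord) ∩ `I₀*` partner of rank `≥ r₁` (`p ≥ 5`,
`(p−1) ∤ lcm(e, 2)`) — NO partner certificate, NO schema, NO R-D binder:** `BudgetLeLambdaAt p W b`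
from `hGV`, `hS2`, `hW16`, `hmodD`, a `TorsionIso` certificate, `Σ₀`, ONE census bit
`p ∤ #E(ℚ)_tors`, `r₁ ≤ rank E₁(ℚ)`. PER PAIR; X3♯(G-ord) stays CONSTRUCTION-SHAPED; nothing booked.
[cite: GreenbergVatsal2000, §2 Prop. (2.8) with Remark (2.9), Cor. (2.3), Prop. (2.4), pp. 26–27 (arXiv:math/9906215)]
[cite: Wuthrich2014, Thm. 16 (p. 397)] [cite: GreenbergLNM1716, §2 Prop. 2.4, Prop. 4.14] -/
theorem ClassX3Gord.budgetLeLambdaAt_of_gv_of_s2_of_gordTwoPartner_of_rank_of_not_dvd_lcm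
    (hGV : muLambdaAlg_transfer_of_torsionIso_potOrd_of_not_dvd_torsionOrder)
    (hS2 : imKummer_ge_strictCondition_goodOrdinaryModel)
    (hW16 : Wuthrich2014.thm16_halfEigenCharIdeal_dvd_cyclotomicPrime)
    (hmodD : nonempty_modularParametrizationData) (hp5 : 5 ≤ p) (hX : ClassX3Gord W p)
    (hX₁ : ClassX3Gord W₁ p) (he₁ : semistabilityIndex W₁ p = 2) {r₁ : ℕ}
    (hr₁ : r₁ ≤ W₁.mordellWeilRank) (hlcm : ¬ (p - 1) ∣ Nat.lcm (semistabilityIndex W p) 2)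
    (htors : ¬ p ∣ W.torsionOrder) (hT : TorsionIso W W₁ p)
    (S₀ : Finset (HeightOneSpectrum (𝓞 ℚ))) (hS₀ : ∀ w ∈ S₀, ((p : ℕ) : 𝓞 ℚ) ∉ w.asIdeal)
    (hS : ∀ w : HeightOneSpectrum (𝓞 ℚ), w ∉ S₀ → ((p : ℕ) : 𝓞 ℚ) ∉ w.asIdeal →
      W.HasGoodReductionAt w)
    (hS₁ : ∀ w : HeightOneSpectrum (𝓞 ℚ), w ∉ S₀ → ((p : ℕ) : 𝓞 ℚ) ∉ w.asIdeal →
      W₁.HasGoodReductionAt w)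
    {b : ℕ} (hb : (b : ℤ) ≤ r₁ + ∑ w ∈ S₀, ((delta W₁ p w : ℤ) - (delta W p w : ℤ))) :
    BudgetLeLambdaAt p W b :=
  hX.budgetLeLambdaAt_of_gv_of_gordTwoPartner_of_rank_of_not_dvd_lcm hGV
    (imKummer_ge_strictCondition_goodOrdinary_of_goodOrdinaryModel hS2) hW16 hmodD hp5
    (ramifiedLineKummerEqAt_of_s2_of_typeGOrd hS2 hp5 hX.typeGOrd hX.addv) hX₁ he₁ hr₁ hlcm htors hT S₀ hS₀
    hS hS₁ hb

/-- **X3♯(G-ord) receiver of ANY defect, X3♯(M) partner of rank `≥ r₁` (`p ≥ 5`, `(p−1) ∤ lcm(e, 2)`)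
— NO partner certificate, NO schema, NO R-D binder**, mod `hGV`, `hS2`, A40/A41, `hW16`, `hmodD`; one
census torsion bit. PER PAIR; nothing booked.
[cite: GreenbergVatsal2000, §2 Prop. (2.8) with Remark (2.9), Cor. (2.3), Prop. (2.4), pp. 26–27 (arXiv:math/9906215)]
[cite: Wuthrich2014, Thm. 16 (p. 397)] [cite: SilvermanATAEC1994, Ch. V Thm. 5.3, Cor. 5.4] -/
theorem ClassX3Gord.budgetLeLambdaAt_of_gv_of_s2_of_multPartner_of_rank_of_not_dvd_lcm
    (hGV : muLambdaAlg_transfer_of_torsionIso_potOrd_of_not_dvd_torsionOrder)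
    (hS2 : imKummer_ge_strictCondition_goodOrdinaryModel)
    (hW16 : Wuthrich2014.thm16_halfEigenCharIdeal_dvd_cyclotomicPrime)
    (hmodD : nonempty_modularParametrizationData)
    (hT40 : Silverman1994_thmV53_tateUniformisation.{0})
    (hT41 : Silverman1994_thmV53_corV54_tateUniformisation.{0}) (hp5 : 5 ≤ p) (hX : ClassX3Gord W p)
    (hX₁ : ClassX3M W₁ p) {r₁ : ℕ} (hr₁ : r₁ ≤ W₁.mordellWeilRank)
    (hlcm : ¬ (p - 1) ∣ Nat.lcm (semistabilityIndex W p) 2) (htors : ¬ p ∣ W.torsionOrder)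
    (hT : TorsionIso W W₁ p)
    (S₀ : Finset (HeightOneSpectrum (𝓞 ℚ))) (hS₀ : ∀ w ∈ S₀, ((p : ℕ) : 𝓞 ℚ) ∉ w.asIdeal)
    (hS : ∀ w : HeightOneSpectrum (𝓞 ℚ), w ∉ S₀ → ((p : ℕ) : 𝓞 ℚ) ∉ w.asIdeal →
      W.HasGoodReductionAt w)
    (hS₁ : ∀ w : HeightOneSpectrum (𝓞 ℚ), w ∉ S₀ → ((p : ℕ) : 𝓞 ℚ) ∉ w.asIdeal →
      W₁.HasGoodReductionAt w)
    {b : ℕ} (hb : (b : ℤ) ≤ r₁ + ∑ w ∈ S₀, ((delta W₁ p w : ℤ) - (delta W p w : ℤ))) :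
    BudgetLeLambdaAt p W b :=
  hX.budgetLeLambdaAt_of_gv_of_multPartner_of_rank_of_not_dvd_lcm hGV hW16 hmodD hT40 hT41 hp5
    (ramifiedLineKummerEqAt_of_s2_of_typeGOrd hS2 hp5 hX.typeGOrd hX.addv) hX₁ hr₁ hlcm htors hT S₀ hS₀ hS
    hS₁ hb

end Summit.BirchSwinnertonDyer.Rank1Residual.Additive

end
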